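import Summits.AtomisticToContinuum.BoseEinsteinCondensation.Theorems.BECCutLineWeakDisorderTwoReplicaTransienceBoundMeanFreeWindow
import Summits.AtomisticToContinuum.BoseEinsteinCondensation.Theorems.BECCutLineWeakDisorderTwoReplicaTransienceBoundShortTime
import HarnessLib

/-!
# Crux `TwoReplicaTransienceBound` (stmt-AtomisticToContinuum-9687), line `SketchIdeator1` v7:
# the crux is EQUIVALENT to its restriction beyond the mean-free time

Support file (`--supports stmt-AtomisticToContinuum-9687`, lead c4; toolbox stub
`twoReplicaTransienceBound_iff_beyondMeanFreeTime`). Given the mean-free window `stub_meanFreeWindow` (…MeanFreeWindow.lean,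
all admissible `v`), the crux `TwoReplicaTransienceBound` is equivalent to the v7 open stub `stub_beyondMeanFreeTime`:

`∀ v admissible, ∀ κ > 0, ∃ ρ₀ > 0, ∀ ρ ∈ (0,ρ₀), ∃ C > 0, ∀ᶠ n, ∀ T ≥ κ/ρ: ∫ L³ m_T²/s_T² ≤ C`

(forward: the crux in its `∀ T ≥ 0` form `twoReplicaTransienceBound_iff_allT`, …ShortTime.lean, restricted to `T ≥ κ/ρ ≥ 0`;
backward: below `min ρ₀ ρ₁` a polymer length is either `≤ κ/ρ` (window, constant `20`) or `≥ κ/ρ`, the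
hypothesis being used at the window's own `κ = κ(R)`). So, for every admissible pair potential, the
open content of the crux lives at polymer lengths beyond the kinetic time `κ(R)/ρ` (hard cores: beyond an absolute number of
mean-free times, `stub_kineticWindow`), where inserting the tagged line costs `e^{-μT}`, `μ ≍ ρa`, and only the genuine
two-replica (Lyapunov-exponent) identity can work.
-/

noncomputable section

namespace Summit.AtomisticToContinuum.BoseEinsteinCondensation.Cruxes.TwoReplicaTransienceBound.TracerDecoupling

open MeasureTheory Filter Set
open scoped ENNReal NNReal Topology BigOperators
open Literature.MathematicalPhysics.QuantumManyBody.BoseGas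

/-- **Registered toolbox stub `twoReplicaTransienceBound_iff_beyondMeanFreeTime`**: the crux `TwoReplicaTransienceBound` is
EQUIVALENT to the v7 open stub `stub_beyondMeanFreeTime` (the bound from the polymer length `κ/ρ` on, for every `κ > 0`) —
forward by `twoReplicaTransienceBound_iff_allT` (`T ≥ κ/ρ ≥ 0`), backward by the composition with the landed mean-free window
`stub_meanFreeWindow`. The open content of the crux is thus pinned, for EVERY admissible `v`, beyond the kinetic time. -/
theorem twoReplicaTransienceBound_iff_beyondMeanFreeTime :
    Summit.AtomisticToContinuum.BoseEinsteinCondensation.Theses.BECCutLineWeakDisorder.TwoReplicaTransienceBound ↔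
      ∀ (v : ℝ → ENNReal), IsRepulsiveFiniteRange v → ∀ κ : ℝ, 0 < κ → ∃ ρ₀ : ℝ, 0 < ρ₀ ∧
        ∀ ρ : ℝ, 0 < ρ → ρ < ρ₀ → ∃ C : ℝ, 0 < C ∧ ∀ᶠ n : ℕ in Filter.atTop, ∀ T : ℝ, κ / ρ ≤ T →
          ∫⁻ Y : Config n, ENNReal.ofReal (sideLength ρ (n + 1) ^ 3) *
              (∫⁻ x, (‖@fkWitness (n + 1) v (sideLength ρ (n + 1)) T (fun _ => (1 : ENNReal))
                (Matrix.vecCons x Y)‖₊ : ENNReal) ^ 2) ^ 2 /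
              (∫⁻ x, (‖@fkWitness (n + 1) v (sideLength ρ (n + 1)) T (fun _ => (1 : ENNReal))
                (Matrix.vecCons x Y)‖₊ : ENNReal)) ^ 2 ≤ ENNReal.ofReal C := by
  constructor
  · intro h v hv κ hκ
    obtain ⟨ρ₀, hρ₀, H⟩ := twoReplicaTransienceBound_iff_allT.1 h v hv
    refine ⟨ρ₀, hρ₀, fun ρ hρ hρlt => ?_⟩
    obtain ⟨C, hC, ev⟩ := H ρ hρ hρlt
    refine ⟨C, hC, ?_⟩
    filter_upwards [ev] with n hn T hT
    exact hn T ((div_nonneg hκ.le hρ.le).trans hT)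
  · intro hB v hv
    obtain ⟨κ, hκ, ρ₁, hρ₁, HW⟩ := stub_meanFreeWindow v hv
    obtain ⟨ρ₀, hρ₀, HB⟩ := hB v hv κ hκ
    refine ⟨min ρ₀ ρ₁, lt_min hρ₀ hρ₁, fun ρ hρ hρlt => ?_⟩
    obtain ⟨C, hC, evB⟩ := HB ρ hρ (hρlt.trans_le (min_le_left _ _))
    have evW := HW ρ hρ (hρlt.trans_le (min_le_right _ _))
    refine ⟨max C 20, lt_max_of_lt_left hC, ?_⟩
    filter_upwards [evB, evW] with n hnB hnW T hT
    rcases le_total T (κ / ρ) with h | h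
    · exact (hnW T (zero_le_one.trans hT) h).trans (ENNReal.ofReal_le_ofReal (le_max_right _ _))
    · exact (hnB T h).trans (ENNReal.ofReal_le_ofReal (le_max_left _ _))

/-- **The mean-free window contains c3's short window** (sanity/monotonicity of the reshape, kernel-checked): from
`stub_meanFreeWindow` one recovers `∀ T₀ > 0, ∃ ρ₁' > 0, ∀ ρ < ρ₁', ∀ᶠ n, ∀ T ∈ [0,T₀], … ≤ 20` with `ρ₁' = min ρ₁ (κ/T₀)`
(for `ρ < κ/T₀`, `T ≤ T₀ ≤ κ/ρ`). -/
theorem shortWindow_of_meanFreeWindow (v : ℝ → ENNReal) (hv : IsRepulsiveFiniteRange v) (T₀ : ℝ) (hT₀ : 0 < T₀) :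
    ∃ ρ₁ : ℝ, 0 < ρ₁ ∧ ∀ ρ : ℝ, 0 < ρ → ρ < ρ₁ → ∀ᶠ n : ℕ in Filter.atTop, ∀ T : ℝ, 0 ≤ T → T ≤ T₀ →
      ∫⁻ Y : Config n, ENNReal.ofReal (sideLength ρ (n + 1) ^ 3) *
          (∫⁻ x, (‖@fkWitness (n + 1) v (sideLength ρ (n + 1)) T (fun _ => (1 : ENNReal))
            (Matrix.vecCons x Y)‖₊ : ENNReal) ^ 2) ^ 2 /
          (∫⁻ x, (‖@fkWitness (n + 1) v (sideLength ρ (n + 1)) T (fun _ => (1 : ENNReal))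
            (Matrix.vecCons x Y)‖₊ : ENNReal)) ^ 2 ≤ ENNReal.ofReal 20 := by
  obtain ⟨κ, hκ, ρ₁, hρ₁, HW⟩ := stub_meanFreeWindow v hv
  refine ⟨min ρ₁ (κ / T₀), lt_min hρ₁ (div_pos hκ hT₀), fun ρ hρ hρlt => ?_⟩
  have ev := HW ρ hρ (hρlt.trans_le (min_le_left _ _))
  filter_upwards [ev] with n hn T hT hTT₀
  refine hn T hT (hTT₀.trans ?_)
  -- `T₀ ≤ κ/ρ` from `ρ < κ/T₀`
  have h1 : ρ < κ / T₀ := hρlt.trans_le (min_le_right _ _)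
  rw [lt_div_iff₀ hT₀] at h1
  rw [le_div_iff₀ hρ]
  linarith [mul_comm ρ T₀]

end Summit.AtomisticToContinuum.BoseEinsteinCondensation.Cruxes.TwoReplicaTransienceBound.TracerDecoupling

end
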